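/-
Copyright (c) 2026 the pub-hodgecm-mathlib formalisation cell (harness21).  Prover seat hodgecm-mathlib-K2E1-p13 (g4), Track B ∕ K2-LIT, h413 = `stmt-HodgeConjecture-24833`,
R90-TF section S8 «ContSpec-n½», #2 chain (G side), deal S8-R67 (2) of R90-CS-plan (g2): R6₃ «OF LETTERS» — the block-orthogonality letter `hBO` of (O₃)
`R90S8ResGResiduesOrthogonalWavePacketsU3` with the associate relation FIXED to the Weyl-associate relation on Borel pair data, modulo ONE visible generator-level letter (XF)₃
(census `R90/S8/CENSUS-R6U3.K2E1-p13-g4.md`: the N = 3 idele × `U(1)` split of the pseudo-Eisenstein inner product is not in the tree).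
-/
import Summits.HodgeConjecture.HodgeConjecture.Theorems.R90S8ResGBlockDataU3Defs                     -- ★ p862621 (K2E1-p11): `resGBlock` (D1) over ★ `chiSectionSpacePair`
import Summits.HodgeConjecture.HodgeConjecture.Theorems.K2E1ChiPseudoEisensteinFamiliesOrthogonalCMTwo   -- ★ p861668 (R6 at N = 2): §3 generic `isOrtho_topologicalClosure_of_isOrtho`; brings ★ `reflectChar`
import HarnessLib

/-!
# S8 #2 chain, R6₃ — `K2E1ChiPseudoEisensteinFamiliesOrthogonalCMThree`: NON-ASSOCIATE BOREL PAIR DATA `(χ₁, χ₂)`, `(χ₁′, χ₂′)` OF `U(Φ₃)` HAVE ORTHOGONAL PSEUDO-EISENSTEIN BLOCKS —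
# `resGBlock (χ₁,χ₂) ⟂ resGBlock (χ₁′,χ₂′)`, MODULO the generator-level vanishing letter (XF)₃ «`⟪[θ_{f,φ}], [θ_{f′,φ′}]⟫ = 0`» (stated on the CONTINUOUS-profile generators of D1)

Track B ∕ K2-LIT, crux h413 = `stmt-HodgeConjecture-24833`, route of record `HCCMUnconditional`; cell `hodgecm-mathlib`, R90-TF programme, section S8 «ContSpec-n½», socket #2
`sock_S8_res_classification` (B ED. 4 :205), G-side letter chain.  THEOREMS ONLY (no `def`, no `instance`, no `notation`, no named-fact hypothesis, no `sorry`; default heartbeats);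
lane `--supports stmt-HodgeConjecture-24833 --as helper` (count-neutral).  CLOSES NO SOCKET: it pays (O₃)'s visible letter
`hBO : ∀ b b', b ≠ b' → ¬ Assoc b b' → resGBlock L μ K' ω (χ₁ b) (χ₂ b) ⟂ resGBlock L μ K' ω (χ₁ b') (χ₂ b')` (★∕📤 `R90S8ResGResiduesOrthogonalWavePacketsU3` :140) with
`Assoc` FIXED to the WEYL-ASSOCIATE RELATION on pair data — `(χ₁′, χ₂′) ∈ {(χ₁, χ₂), (χ₁ʷ, χ₂)}`, `χ₁ʷ = reflectChar c χ₁` (★ `K2E1ChiSectionSpaceU3PairDefs.HasReflectedIntertwiningPair`: the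
long Weyl element of `U(2,1)` sends `diag(a, u, ā⁻¹) ↦ diag(ā⁻¹, u, a)`, so it reflects `χ₁` and FIXES the middle `U(1)`-character `χ₂`) — spelled INLINE as a disjunction (no `def`).

THE MATHEMATICS ([MoeglinWaldspurger1995] II.2.1: pseudo-Eisenstein series attached to non-associate cuspidal data are orthogonal; [Rogawski1990] §13.9 p. 229).  For the Borel
`B = M N` of `G = U(Φ₃)`, `M ≅ Res_{L∕L⁺} GL₁ × U(1)`, the cuspidal data are the pair characters `(χ₁, χ₂)` and `W(M) = {1, w}`.  Unfolding `⟨θ_{f,φ}, θ_{f′,φ′}⟩_{L²(G(L⁺)∖G(𝔸))}`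
(★ GENERIC `K2E1PseudoEisensteinUnfolding`) against the constant term of `θ_{f′,φ′}` along `B` gives two terms indexed by `W`, each an integral over `M(L⁺)∖M(𝔸)¹ × ℝ_{>0}` of
`(χ₁,χ₂)·conj(w·(χ₁′,χ₂′))` times profile data; Tate's Lemma B on the idele class group (★ GR-χ `K2E1IdeleClassCharacterOrthogonality`) and orthogonality on the compact torus
`U(1)(L⁺)∖U(1)(𝔸)` kill both unless `(χ₁′, χ₂′)` is `W`-associate to `(χ₁, χ₂)` (for RAY-TRIVIAL `χ₁` «associate up to a norm twist» IS equality: ★ `eq_of_isNormTwist_mul_inv_of_rayTrivial`).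
THIS FILE does the `L²` BOOKKEEPING ONLY: generator-level orthogonality ⇒ block orthogonality (`Submodule.isOrtho_span` + ★ `isOrtho_topologicalClosure_of_isOrtho`; the letter is
stated on D1's CONTINUOUS-profile generating set, so NO density step is needed).  HONEST SCOPE: the generator-level vanishing (XF)₃ — the N = 3 twin of ★ H-a∕H-b
`K2E1ChiPseudoEisensteinIdeleSplitCMTwo` ∕ `K2E1ChiPseudoEisensteinInnerProductCMTwo` (idele × `U(1)` split over the Levi `L^× × U(1)`, both Weyl terms) — is NOT in the tree and
stays a VISIBLE LETTER `hXF` here (census §3: L-sized; its payer file would be `K2E1ChiPseudoEisensteinIdeleSplitCMThree` + `…InnerProductCMThree`).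
* §1 `isOrtho_topologicalClosure_span_of_forall_inner_eq_zero` (generic Hilbert bookkeeping), **`isOrtho_resGBlock_of_generators`** (one pair of pair data).
* §2 HEAD **`hBO_of_pairXF`** — (O₃)'s `hBO` over an index `β` with `Assoc := PairAssoc` inline, from (XF)₃; `hBO_of_pairXF_rayTrivial` (the same with the two `≠` letters
  `χ₁ b' ≠ χ₁ b ∨ χ₂ b' ≠ χ₂ b` and `χ₁ b' ≠ (χ₁ b)ʷ ∨ χ₂ b' ≠ χ₂ b` as the consumer usually has them).
HONEST LABEL: HC_CM is proved only modulo the 7 printed citations (2 remaining named inputs: hLiu418 = `stmt-HodgeConjecture-24832`, h413 = `stmt-HodgeConjecture-24833`) until rung 0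
closes; REL ≠ ★ ≠ BUILT; this file asserts no named fact, is conditional by construction on its visible binder `hXF`, and closes no socket; count-neutral.

## References
* [MoeglinWaldspurger1995] C. Mœglin, J.-L. Waldspurger, *Spectral Decomposition and Eisenstein Series* (1995), II.1.7, II.2.1.
* [Rogawski1990] J. D. Rogawski, *Automorphic Representations of Unitary Groups in Three Variables* (1990), §13.9 p. 229.
* [TateThesis1967] J. Tate, *Fourier analysis in number fields and Hecke's zeta-functions*, in Cassels–Fröhlich (1967), §4.3, Thm. 4.4.1.
-/

set_option autoImplicit false
set_option linter.dupNamespace false  -- the mandated namespace repeats `HodgeConjecture.HodgeConjecture`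

noncomputable section

open MeasureTheory Measure Set Filter Topology NumberField
open Literature.NumberTheory.Automorphic Literature.NumberTheory.Automorphic.UnitaryGroup Literature.NumberTheory.GaloisRepresentations AdelicGroupData
open Literature.NumberTheory.Automorphic.Arthur2013.Leaves.TECR
open Summit.HodgeConjecture.HodgeConjecture.Cruxes.H413.K2E1BorelEisensteinU
open Summit.HodgeConjecture.HodgeConjecture.Cruxes.H413.K2E1CharacterEisensteinU2Defs (reflectChar)
open Summit.HodgeConjecture.HodgeConjecture.Cruxes.H413.K2E1ChiSectionSpaceU3PairDefs
open Summit.HodgeConjecture.HodgeConjecture.Cruxes.H413.K2E1ChiPseudoEisensteinFamiliesOrthogonalCMTwo (isOrtho_topologicalClosure_of_isOrtho)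
open Summit.HodgeConjecture.HodgeConjecture.R90.S8 (resGBlock)
open scoped ENNReal NNReal InnerProductSpace

namespace Summit.HodgeConjecture.HodgeConjecture.Cruxes.H413.K2E1ChiPseudoEisensteinFamiliesOrthogonalCMThree

/-! ## §1 Generator-level orthogonality ⇒ block orthogonality -/

/-- **Hilbert bookkeeping**: if every element of `S` is orthogonal to every element of `T`, the CLOSED spans are orthogonal (`Submodule.isOrtho_span` + ★ `isOrtho_topologicalClosure_of_isOrtho`).
[folklore] -/
theorem isOrtho_topologicalClosure_span_of_forall_inner_eq_zero {E : Type*} [NormedAddCommGroup E] [InnerProductSpace ℂ E] {S T : Set E}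
    (h : ∀ u ∈ S, ∀ v ∈ T, ⟪u, v⟫_ℂ = 0) : (Submodule.span ℂ S).topologicalClosure ⟂ (Submodule.span ℂ T).topologicalClosure :=
  isOrtho_topologicalClosure_of_isOrtho (Submodule.isOrtho_span.2 fun u hu v hv => h u hu v hv)

variable (L : Type) [Field L] [NumberField L] [IsCMField L]
  (μ : Measure (quasiSplit (↥(maximalRealSubfield L)) L (IsCMField.complexConj L) 3).automorphicQuotient)

/-- **ONE PAIR OF PAIR DATA**: if every continuous-profile pseudo-Eisenstein generator of the `(χ₁, χ₂)`-block at `(K′, ω)` is orthogonal to every generator of the `(χ₁′, χ₂′)`-block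
(the (XF)₃ statement for these two data), then `resGBlock (χ₁,χ₂) ⟂ resGBlock (χ₁′,χ₂′)` (D1 = closed span of exactly these generators). [cite: MoeglinWaldspurger1995, II.2.1] -/
theorem isOrtho_resGBlock_of_generators (K' : Subgroup (quasiSplit (↥(maximalRealSubfield L)) L (IsCMField.complexConj L) 3).Adelic) (ω : ↥K' →* ℂ)
    (χ₁ χ₁' : HeckeCharacter L) (χ₂ χ₂' : ↥(TorusDict.torus (IsCMField.complexConj L)) →ₜ* ℂˣ)
    (hXF : ∀ (f : ℝ → ℂ) (_ : Continuous f) (_ : HasCompactSupport f) (_ : tsupport f ⊆ Ioi 0)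
        (φ : (quasiSplit (↥(maximalRealSubfield L)) L (IsCMField.complexConj L) 3).Adelic → ℂ) (_ : φ ∈ chiSectionSpacePair χ₁ χ₂ K' (ω : ↥K' → ℂ)) (_ : Continuous φ)
        (hv : MemLp ((quasiSplit (↥(maximalRealSubfield L)) L (IsCMField.complexConj L) 3).quotFun (eisensteinSeriesU (fun g => f (borelHeight g) * φ g))) 2 μ)
        (f' : ℝ → ℂ) (_ : Continuous f') (_ : HasCompactSupport f') (_ : tsupport f' ⊆ Ioi 0)
        (φ' : (quasiSplit (↥(maximalRealSubfield L)) L (IsCMField.complexConj L) 3).Adelic → ℂ) (_ : φ' ∈ chiSectionSpacePair χ₁' χ₂' K' (ω : ↥K' → ℂ)) (_ : Continuous φ')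
        (hv' : MemLp ((quasiSplit (↥(maximalRealSubfield L)) L (IsCMField.complexConj L) 3).quotFun (eisensteinSeriesU (fun g => f' (borelHeight g) * φ' g))) 2 μ),
        ⟪hv.toLp _, hv'.toLp _⟫_ℂ = 0) :
    resGBlock L μ K' ω χ₁ χ₂ ⟂ resGBlock L μ K' ω χ₁' χ₂' := by
  refine isOrtho_topologicalClosure_span_of_forall_inner_eq_zero fun u hu v hv => ?_
  obtain ⟨f, hf, hfs, hf0, φ, hφ, hφc, hmem, rfl⟩ := hu
  obtain ⟨f', hf', hfs', hf0', φ', hφ', hφc', hmem', rfl⟩ := hv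
  exact hXF f hf hfs hf0 φ hφ hφc hmem f' hf' hfs' hf0' φ' hφ' hφc' hmem'

/-! ## §2 HEAD — (O₃)'s `hBO` with the Weyl-associate relation on pair data, from the visible letter (XF)₃ -/

/-- **R6₃ OF LETTERS — NON-ASSOCIATE BOREL PAIR DATA HAVE ORTHOGONAL BLOCKS.**  Index `β`, pair data `(χ₁ b, χ₂ b)`, level datum `(K′, ω)`.  The Weyl-associate relation
`PairAssoc b b′ :↔ (χ₁ b′ = χ₁ b ∧ χ₂ b′ = χ₂ b) ∨ (χ₁ b′ = (χ₁ b)ʷ ∧ χ₂ b′ = χ₂ b)` is spelled inline.  VISIBLE LETTER (XF)₃ `hXF`: for `b ≠ b′` NOT associate, every continuous-profile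
generator of the `b`-block is orthogonal to every generator of the `b′`-block (the N = 3 twin of ★ (XF) `chiPseudoEisenstein_inner_product_eq_zero_cm_two`; unfolding + Levi split, not
in the tree).  THEN (O₃)'s `hBO` with `Assoc := PairAssoc`: `∀ b b′, b ≠ b′ → ¬PairAssoc b b′ → resGBlock … b ⟂ resGBlock … b′`.  CONSUMER: ★∕📤 (O₃)
`isOrtho_iSup_resGAtom_iSup_resGLine_of_letters … (Assoc := PairAssoc) (hBO := hBO_of_pairXF …) hOD`. [cite: MoeglinWaldspurger1995, II.2.1] [cite: Rogawski1990, §13.9 p. 229] -/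
theorem hBO_of_pairXF {β : Type*} (K' : Subgroup (quasiSplit (↥(maximalRealSubfield L)) L (IsCMField.complexConj L) 3).Adelic) (ω : ↥K' →* ℂ)
    (χ₁ : β → HeckeCharacter L) (χ₂ : β → (↥(TorusDict.torus (IsCMField.complexConj L)) →ₜ* ℂˣ))
    (hXF : ∀ b b' : β, b ≠ b' →
      ¬ ((χ₁ b' = χ₁ b ∧ χ₂ b' = χ₂ b) ∨ (χ₁ b' = reflectChar (IsCMField.complexConj L) (χ₁ b) ∧ χ₂ b' = χ₂ b)) →
      ∀ (f : ℝ → ℂ) (_ : Continuous f) (_ : HasCompactSupport f) (_ : tsupport f ⊆ Ioi 0)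
        (φ : (quasiSplit (↥(maximalRealSubfield L)) L (IsCMField.complexConj L) 3).Adelic → ℂ) (_ : φ ∈ chiSectionSpacePair (χ₁ b) (χ₂ b) K' (ω : ↥K' → ℂ)) (_ : Continuous φ)
        (hv : MemLp ((quasiSplit (↥(maximalRealSubfield L)) L (IsCMField.complexConj L) 3).quotFun (eisensteinSeriesU (fun g => f (borelHeight g) * φ g))) 2 μ)
        (f' : ℝ → ℂ) (_ : Continuous f') (_ : HasCompactSupport f') (_ : tsupport f' ⊆ Ioi 0)
        (φ' : (quasiSplit (↥(maximalRealSubfield L)) L (IsCMField.complexConj L) 3).Adelic → ℂ) (_ : φ' ∈ chiSectionSpacePair (χ₁ b') (χ₂ b') K' (ω : ↥K' → ℂ)) (_ : Continuous φ')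
        (hv' : MemLp ((quasiSplit (↥(maximalRealSubfield L)) L (IsCMField.complexConj L) 3).quotFun (eisensteinSeriesU (fun g => f' (borelHeight g) * φ' g))) 2 μ),
        ⟪hv.toLp _, hv'.toLp _⟫_ℂ = 0) :
    ∀ b b' : β, b ≠ b' →
      ¬ ((χ₁ b' = χ₁ b ∧ χ₂ b' = χ₂ b) ∨ (χ₁ b' = reflectChar (IsCMField.complexConj L) (χ₁ b) ∧ χ₂ b' = χ₂ b)) →
      resGBlock L μ K' ω (χ₁ b) (χ₂ b) ⟂ resGBlock L μ K' ω (χ₁ b') (χ₂ b') :=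
  fun b b' hne hna => isOrtho_resGBlock_of_generators L μ K' ω (χ₁ b) (χ₁ b') (χ₂ b) (χ₂ b') (hXF b b' hne hna)

/-- **THE SAME WITH THE CONSUMER'S `≠` LETTERS**: if for `b ≠ b′` the pair data differ from BOTH `(χ₁ b, χ₂ b)` and `((χ₁ b)ʷ, χ₂ b)` (as the index families of record are built — distinct
indices carry distinct, non-reflected data), `PairAssoc b b′` fails, so (XF)₃ gives `hBO` with ANY `Assoc` (in particular (O₃)'s abstract one): `∀ b b′, b ≠ b′ → ¬Assoc b b′ → Blk b ⟂ Blk b′`.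
[cite: MoeglinWaldspurger1995, II.2.1] -/
theorem hBO_of_pairXF_of_ne {β : Type*} (K' : Subgroup (quasiSplit (↥(maximalRealSubfield L)) L (IsCMField.complexConj L) 3).Adelic) (ω : ↥K' →* ℂ)
    (χ₁ : β → HeckeCharacter L) (χ₂ : β → (↥(TorusDict.torus (IsCMField.complexConj L)) →ₜ* ℂˣ)) (Assoc : β → β → Prop)
    (hsep : ∀ b b' : β, b ≠ b' → ¬ Assoc b b' →
      ¬ ((χ₁ b' = χ₁ b ∧ χ₂ b' = χ₂ b) ∨ (χ₁ b' = reflectChar (IsCMField.complexConj L) (χ₁ b) ∧ χ₂ b' = χ₂ b)))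
    (hXF : ∀ b b' : β, b ≠ b' →
      ¬ ((χ₁ b' = χ₁ b ∧ χ₂ b' = χ₂ b) ∨ (χ₁ b' = reflectChar (IsCMField.complexConj L) (χ₁ b) ∧ χ₂ b' = χ₂ b)) →
      ∀ (f : ℝ → ℂ) (_ : Continuous f) (_ : HasCompactSupport f) (_ : tsupport f ⊆ Ioi 0)
        (φ : (quasiSplit (↥(maximalRealSubfield L)) L (IsCMField.complexConj L) 3).Adelic → ℂ) (_ : φ ∈ chiSectionSpacePair (χ₁ b) (χ₂ b) K' (ω : ↥K' → ℂ)) (_ : Continuous φ)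
        (hv : MemLp ((quasiSplit (↥(maximalRealSubfield L)) L (IsCMField.complexConj L) 3).quotFun (eisensteinSeriesU (fun g => f (borelHeight g) * φ g))) 2 μ)
        (f' : ℝ → ℂ) (_ : Continuous f') (_ : HasCompactSupport f') (_ : tsupport f' ⊆ Ioi 0)
        (φ' : (quasiSplit (↥(maximalRealSubfield L)) L (IsCMField.complexConj L) 3).Adelic → ℂ) (_ : φ' ∈ chiSectionSpacePair (χ₁ b') (χ₂ b') K' (ω : ↥K' → ℂ)) (_ : Continuous φ')
        (hv' : MemLp ((quasiSplit (↥(maximalRealSubfield L)) L (IsCMField.complexConj L) 3).quotFun (eisensteinSeriesU (fun g => f' (borelHeight g) * φ' g))) 2 μ),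
        ⟪hv.toLp _, hv'.toLp _⟫_ℂ = 0) :
    ∀ b b' : β, b ≠ b' → ¬ Assoc b b' → resGBlock L μ K' ω (χ₁ b) (χ₂ b) ⟂ resGBlock L μ K' ω (χ₁ b') (χ₂ b') :=
  fun b b' hne hna => hBO_of_pairXF L μ K' ω χ₁ χ₂ hXF b b' hne (hsep b b' hne hna)

end Summit.HodgeConjecture.HodgeConjecture.Cruxes.H413.K2E1ChiPseudoEisensteinFamiliesOrthogonalCMThree

end
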